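import Mathlib.Analysis.PSeries
import Literature.NumberTheory.Sieve.BatemanHornMertensProduct
import Literature.NumberTheory.Sieve.BombieriAsymptoticSieveMertens
import Literature.NumberTheory.Sieve.PolynomialCongruencesLemmas
import Literature.NumberTheory.Sieve.PolynomialCongruencesProofs

/-!
# The Euler majorant for `∑_{m ≤ N} τ(m) ρ_g(m)/m` against the sieve product `P_g(N)`

Solo informed line (Parity / Bateman–Horn), session 137; the elementary input of
`SoloInformedErdosUpperBoundNT` (Erdős's upper bound `∑_{n ≤ x} τ(|g(n)|) ≪ x log x` from the
Nair–Tenenbaum named fact).  Throughout `ρ_g(n) = polyRootCountMod ![g] n` is the number of roots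
of `g` modulo `n` and `P_g(N) = ∏_{p ≤ N} (1 − ρ_g(p)/p)`.  Everything here is PROVED, hypothesis-free
beyond the data:

* `one_sub_rho_div_pos`, `sieveProd_pos` — no fixed prime divisor ⟹ `P_g(N) > 0`;
* `exists_pos_le_log_mul_sieveProd` — **Mertens along `g`, lower-bound form**: from the tree's
  PROVED `BatemanHornMertens.tendsto_log_mul_prod_one_sub_rootCount_single`
  (`log N · P_g(N) → C(g) e^{−γ} > 0`), some `c > 0` has `c ≤ log N · P_g(N)` for all `N ≥ 2`;
* `tauRhoDiv_mul`, `tauRhoDiv_prime_pow_le`, `sum_range_tauRhoDiv_prime_pow_le` — the summand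
  `h(m) = τ(m)ρ_g(m)/m` is multiplicative with Euler factor partial sums
  `≤ 1 + 2ρ_g(p)/p + 16W/p²` once `ρ_g(p^a) ≤ W` for all prime powers;
* `sum_tauRhoDiv_le_prod` — the Euler majorant
  `∑_{m ≤ N} τ(m)ρ_g(m)/m ≤ ∏_{p ≤ N} (1 + 2ρ_g(p)/p + 16W/p²)` (tree:
  `BombieriSieve.sum_le_prod_tsum_of_factored`);
* `sum_tauRhoDiv_le_exp_div_sieveProd_sq` — hence, by `1 + 2t + s ≤ (1 − t)⁻²(1 + s)` and
  `∏ (1 + K/p²) ≤ e^{2K}`, `∑_{m ≤ N} τ(m)ρ_g(m)/m ≤ e^{32W} · P_g(N)⁻²`.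

No definitions, no named facts.
-/

open Finset Real Polynomial Filter Topology

namespace Summit.Parity.BatemanHorn.Theorems

open Literature.NumberTheory.Sieve

/-! ### The root count `ρ_g = polyRootCountMod ![g]` and the sieve product `P_g(N)` -/

/-- `ρ_g(n) ≥ 0` (as a real number). [folklore] -/
theorem rho_nonneg (g : ℤ[X]) (n : ℕ) : 0 ≤ (polyRootCountMod ![g] n : ℝ) := Nat.cast_nonneg _

/-- Without a fixed prime divisor every factor `1 − ρ_g(p)/p` is positive. [folklore] -/
theorem one_sub_rho_div_pos {g : ℤ[X]} (hg : HasNoFixedPrimeDivisor ![g]) {p : ℕ} (hp : p.Prime) :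
    0 < 1 - (polyRootCountMod ![g] p : ℝ) / p := by
  have hlt : (polyRootCountMod ![g] p : ℝ) < p := by exact_mod_cast hg p hp
  have hp0 : (0 : ℝ) < p := by exact_mod_cast hp.pos
  rw [sub_pos, div_lt_one hp0]
  exact hlt

/-- `P_g(N) = ∏_{p ≤ N} (1 − ρ_g(p)/p) > 0` when `g` has no fixed prime divisor. [folklore] -/
theorem sieveProd_pos {g : ℤ[X]} (hg : HasNoFixedPrimeDivisor ![g]) (N : ℕ) :
    0 < (∏ p ∈ Nat.primesLE N, (1 - (polyRootCountMod ![g] p : ℝ) / p)) :=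
  prod_pos fun _ hp => one_sub_rho_div_pos hg (Nat.prime_of_mem_primesLE hp)

/-- A positive sequence that is eventually `≥ a > 0` is bounded below by a positive constant on `N ≥ 2`.
[folklore] -/
theorem exists_pos_forall_le_of_eventually {u : ℕ → ℝ} {a : ℝ} (ha : 0 < a)
    (hev : ∀ᶠ N in atTop, a ≤ u N) (hpos : ∀ N, 2 ≤ N → 0 < u N) :
    ∃ c : ℝ, 0 < c ∧ ∀ N, 2 ≤ N → c ≤ u N := by
  obtain ⟨N₁, hN₁⟩ := eventually_atTop.mp hev
  set S : Finset ℕ := Finset.Ico 2 N₁ with hS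
  by_cases hne : S.Nonempty
  · obtain ⟨m, hmS, hm⟩ := S.exists_min_image u hne
    refine ⟨min a (u m), lt_min ha (hpos m (mem_Ico.mp hmS).1), fun N hN => ?_⟩
    by_cases hN₁N : N₁ ≤ N
    · exact (min_le_left _ _).trans (hN₁ N hN₁N)
    · exact (min_le_right _ _).trans (hm N (mem_Ico.mpr ⟨hN, by omega⟩))
  · refine ⟨a, ha, fun N hN => hN₁ N ?_⟩
    by_contra h
    exact hne ⟨N, mem_Ico.mpr ⟨hN, by omega⟩⟩

/-- **Mertens along `g`, lower-bound form**: `P_g(N) ≥ c / log N` for all `N ≥ 2`, some `c > 0`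
(from the tree's PROVED `log N · P_g(N) → C(g)e^{−γ} > 0`). [folklore] -/
theorem exists_pos_le_log_mul_sieveProd {g : ℤ[X]} (hg : IsBatemanHornSystem ![g]) :
    ∃ c : ℝ, 0 < c ∧ ∀ N : ℕ, 2 ≤ N → c ≤ Real.log N * (∏ p ∈ Nat.primesLE N, (1 - (polyRootCountMod ![g] p : ℝ) / p)) := by
  have hT := BatemanHornMertens.tendsto_log_mul_prod_one_sub_rootCount_single hg
  set L : ℝ := batemanHornConst ![g] * Real.exp (-Real.eulerMascheroniConstant) with hL
  have hLpos : 0 < L := mul_pos (IsBatemanHornSystem.hasBatemanHornConst_holds hg).2 (Real.exp_pos _)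
  have hev : ∀ᶠ N : ℕ in atTop, L / 2 ≤ Real.log N * (∏ p ∈ Nat.primesLE N, (1 - (polyRootCountMod ![g] p : ℝ) / p)) :=
    (hT.eventually (eventually_ge_nhds (by linarith : L / 2 < L))).mono fun N h => h
  refine exists_pos_forall_le_of_eventually (half_pos hLpos) hev fun N hN => ?_
  exact mul_pos (Real.log_pos (by exact_mod_cast hN)) (sieveProd_pos hg.hasNoFixedPrimeDivisor N)

/-! ### The Euler majorant for `∑_{m ≤ N} τ(m) ρ_g(m) / m` -/

/-- The summand `τ(m)ρ_g(m)/m` is non-negative. [folklore] -/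
theorem tauRhoDiv_nonneg (g : ℤ[X]) (m : ℕ) :
    0 ≤ ((#m.divisors : ℝ) * (polyRootCountMod ![g] m : ℝ) / m) := by
  positivity

/-- `τ(1)ρ_g(1)/1 = 1`. [folklore] -/
theorem tauRhoDiv_one (g : ℤ[X]) :
    ((#(1 : ℕ).divisors : ℝ) * (polyRootCountMod ![g] 1 : ℝ) / (1 : ℕ)) = 1 := by
  simp [polyRootCountMod_one]

/-- `m ↦ τ(m)ρ_g(m)/m` is multiplicative on coprime arguments (`τ` and `ρ_g` are). [folklore] -/
theorem tauRhoDiv_mul {g : ℤ[X]} {m n : ℕ} (hmn : m.Coprime n) :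
    ((#(m * n).divisors : ℝ) * (polyRootCountMod ![g] (m * n) : ℝ) / (m * n : ℕ)) = ((#m.divisors : ℝ) * (polyRootCountMod ![g] m : ℝ) / m) * ((#n.divisors : ℝ) * (polyRootCountMod ![g] n : ℝ) / n) := by
  rw [Nat.Coprime.card_divisors_mul hmn, polyRootCountMod_mul_of_coprime g hmn]
  push_cast
  rcases Nat.eq_zero_or_pos m with rfl | hm
  · simp
  rcases Nat.eq_zero_or_pos n with rfl | hn
  · simp
  field_simp

/-- `(j + 3) ≤ 4 · (3/2)^j`. [folklore] -/
theorem add_three_le_four_mul_pow (j : ℕ) : ((j : ℝ) + 3) ≤ 4 * (3 / 2 : ℝ) ^ j := by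
  induction j with
  | zero => norm_num
  | succ n ih =>
    have h15 : (0 : ℝ) ≤ (3 / 2 : ℝ) ^ n := by positivity
    push_cast
    calc (n : ℝ) + 1 + 3 ≤ ((n : ℝ) + 3) * (3 / 2) := by linarith
      _ ≤ 4 * (3 / 2 : ℝ) ^ n * (3 / 2) := by nlinarith
      _ = 4 * (3 / 2 : ℝ) ^ (n + 1) := by ring

/-- `∑_{j < m} (3/4)^j ≤ 4`. [folklore] -/
theorem sum_range_three_quarters_pow_le (m : ℕ) : ∑ j ∈ range m, (3 / 4 : ℝ) ^ j ≤ 4 := by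
  have h := geom_sum_eq (x := (3 / 4 : ℝ)) (by norm_num) m
  rw [h]
  have h1 : (0 : ℝ) ≤ (3 / 4 : ℝ) ^ m := by positivity
  have : ((3 / 4 : ℝ) ^ m - 1) / ((3 / 4 : ℝ) - 1) = 4 * (1 - (3 / 4 : ℝ) ^ m) := by ring
  rw [this]; linarith

/-- At a prime power `p^e` with `e = j + 2`: `τ(p^e)ρ_g(p^e)/p^e ≤ W · 4(3/4)^j / p²` whenever
`ρ_g(p^a) ≤ W` for all `a`. [folklore] -/
theorem tauRhoDiv_prime_pow_le {g : ℤ[X]} {p : ℕ} (hp : p.Prime) {W : ℝ}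
    (hW : ∀ a : ℕ, (polyRootCountMod ![g] (p ^ a) : ℝ) ≤ W) (j : ℕ) :
    ((#(p ^ (j + 2)).divisors : ℝ) * (polyRootCountMod ![g] (p ^ (j + 2)) : ℝ) / (p ^ (j + 2) : ℕ)) ≤ W * (4 * (3 / 4 : ℝ) ^ j) / (p : ℝ) ^ 2 := by
  have hp2 : (2 : ℝ) ≤ p := by exact_mod_cast hp.two_le
  have hp0 : (0 : ℝ) < p := by linarith
  have hW0 : 0 ≤ W := (rho_nonneg g (p ^ 0)).trans (hW 0)
  have htau : (#(p ^ (j + 2)).divisors : ℝ) = (j : ℝ) + 3 := by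
    rw [← ArithmeticFunction.sigma_zero_apply, ArithmeticFunction.sigma_zero_apply_prime_pow hp]
    push_cast
    ring
  rw [htau]
  -- `(j+3) ρ / p^{j+2} ≤ 4 (3/2)^j W / (p^j p^2)` and `(3/2)^j / p^j ≤ (3/4)^j`
  have hpow : ((p : ℕ) : ℝ) ^ (j + 2) = (p : ℝ) ^ j * (p : ℝ) ^ 2 := by ring
  have hpj : (2 : ℝ) ^ j ≤ (p : ℝ) ^ j := pow_le_pow_left₀ (by norm_num) hp2 j
  have h2j : (0 : ℝ) < (2 : ℝ) ^ j := by positivity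
  have hρ := hW (j + 2)
  have hρ0 := rho_nonneg g (p ^ (j + 2))
  push_cast at hpow ⊢
  rw [hpow, div_le_div_iff₀ (by positivity) (by positivity)]
  have h34 : (3 / 4 : ℝ) ^ j * (2 : ℝ) ^ j = (3 / 2 : ℝ) ^ j := by
    rw [← mul_pow]; norm_num
  calc ((j : ℝ) + 3) * (polyRootCountMod ![g] (p ^ (j + 2)) : ℝ) * (p : ℝ) ^ 2
      ≤ 4 * (3 / 2 : ℝ) ^ j * W * (p : ℝ) ^ 2 := by
        have := add_three_le_four_mul_pow j
        gcongr
    _ = W * (4 * ((3 / 4 : ℝ) ^ j * (2 : ℝ) ^ j)) * (p : ℝ) ^ 2 := by rw [h34]; ring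
    _ ≤ W * (4 * ((3 / 4 : ℝ) ^ j * (p : ℝ) ^ j)) * (p : ℝ) ^ 2 := by gcongr
    _ = W * (4 * (3 / 4 : ℝ) ^ j) * ((p : ℝ) ^ j * (p : ℝ) ^ 2) := by ring

/-- Partial sums of the Euler factor: `∑_{e < n} τ(p^e)ρ_g(p^e)/p^e ≤ 1 + 2ρ_g(p)/p + 16W/p²`. [folklore] -/
theorem sum_range_tauRhoDiv_prime_pow_le {g : ℤ[X]} {p : ℕ} (hp : p.Prime) {W : ℝ}
    (hW : ∀ a : ℕ, (polyRootCountMod ![g] (p ^ a) : ℝ) ≤ W) (n : ℕ) :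
    ∑ e ∈ range n, ((#(p ^ e).divisors : ℝ) * (polyRootCountMod ![g] (p ^ e) : ℝ) / (p ^ e : ℕ)) ≤ 1 + 2 * (polyRootCountMod ![g] p : ℝ) / p + 16 * W / (p : ℝ) ^ 2 := by
  have hW0 : 0 ≤ W := (rho_nonneg g (p ^ 0)).trans (hW 0)
  have hp0 : (0 : ℝ) < p := by exact_mod_cast hp.pos
  have hnn : ∀ e, 0 ≤ ((#(p ^ e).divisors : ℝ) * (polyRootCountMod ![g] (p ^ e) : ℝ) / (p ^ e : ℕ)) := fun e => tauRhoDiv_nonneg g _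
  -- it suffices to treat `n = m + 2`
  have key : ∀ m : ℕ, ∑ e ∈ range (m + 2), ((#(p ^ e).divisors : ℝ) * (polyRootCountMod ![g] (p ^ e) : ℝ) / (p ^ e : ℕ)) ≤ 1 + 2 * (polyRootCountMod ![g] p : ℝ) / p + 16 * W / (p : ℝ) ^ 2 := by
    intro m
    have hsplit : ∑ e ∈ range (m + 2), ((#(p ^ e).divisors : ℝ) * (polyRootCountMod ![g] (p ^ e) : ℝ) / (p ^ e : ℕ)) =
        ((#(p ^ 0).divisors : ℝ) * (polyRootCountMod ![g] (p ^ 0) : ℝ) / (p ^ 0 : ℕ)) + ((#(p ^ 1).divisors : ℝ) * (polyRootCountMod ![g] (p ^ 1) : ℝ) / (p ^ 1 : ℕ)) + ∑ j ∈ range m, ((#(p ^ (j + 2)).divisors : ℝ) * (polyRootCountMod ![g] (p ^ (j + 2)) : ℝ) / (p ^ (j + 2) : ℕ)) := by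
      have : m + 2 = 2 + m := by omega
      rw [this, Finset.sum_range_add, Finset.sum_range_succ, Finset.sum_range_one]
      simp only [add_comm 2]
    rw [hsplit]
    have h0 : ((#(p ^ 0).divisors : ℝ) * (polyRootCountMod ![g] (p ^ 0) : ℝ) / (p ^ 0 : ℕ)) = 1 := by rw [pow_zero]; exact tauRhoDiv_one g
    have h1 : ((#(p ^ 1).divisors : ℝ) * (polyRootCountMod ![g] (p ^ 1) : ℝ) / (p ^ 1 : ℕ)) = 2 * (polyRootCountMod ![g] p : ℝ) / p := by
      rw [pow_one, Nat.Prime.divisors hp, Finset.card_pair hp.one_lt.ne]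
      push_cast; ring
    rw [h0, h1]
    have htail : ∑ j ∈ range m, ((#(p ^ (j + 2)).divisors : ℝ) * (polyRootCountMod ![g] (p ^ (j + 2)) : ℝ) / (p ^ (j + 2) : ℕ)) ≤ 16 * W / (p : ℝ) ^ 2 := by
      calc ∑ j ∈ range m, ((#(p ^ (j + 2)).divisors : ℝ) * (polyRootCountMod ![g] (p ^ (j + 2)) : ℝ) / (p ^ (j + 2) : ℕ))
          ≤ ∑ j ∈ range m, W * (4 * (3 / 4 : ℝ) ^ j) / (p : ℝ) ^ 2 :=
            Finset.sum_le_sum fun j _ => tauRhoDiv_prime_pow_le hp hW j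
        _ = (4 * W / (p : ℝ) ^ 2) * ∑ j ∈ range m, (3 / 4 : ℝ) ^ j := by
            rw [Finset.mul_sum]; refine Finset.sum_congr rfl fun j _ => ?_; ring
        _ ≤ (4 * W / (p : ℝ) ^ 2) * 4 := by
            gcongr; exact sum_range_three_quarters_pow_le m
        _ = 16 * W / (p : ℝ) ^ 2 := by ring
    linarith
  rcases Nat.lt_or_ge n 2 with hn | hn
  · calc ∑ e ∈ range n, ((#(p ^ e).divisors : ℝ) * (polyRootCountMod ![g] (p ^ e) : ℝ) / (p ^ e : ℕ)) ≤ ∑ e ∈ range 2, ((#(p ^ e).divisors : ℝ) * (polyRootCountMod ![g] (p ^ e) : ℝ) / (p ^ e : ℕ)) :=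
          Finset.sum_le_sum_of_subset_of_nonneg (Finset.range_mono hn.le) fun e _ _ => hnn e
      _ ≤ _ := key 0
  · obtain ⟨m, rfl⟩ := Nat.exists_eq_add_of_le' hn
    exact key m

/-- **Euler majorant**: `∑_{m ≤ N} τ(m)ρ_g(m)/m ≤ ∏_{p ≤ N} (1 + 2ρ_g(p)/p + 16W/p²)`. [folklore] -/
theorem sum_tauRhoDiv_le_prod {g : ℤ[X]} {W : ℝ} (hW : ∀ p : ℕ, p.Prime → ∀ a : ℕ, (polyRootCountMod ![g] (p ^ a) : ℝ) ≤ W)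
    (N : ℕ) :
    ∑ m ∈ Icc 1 N, ((#m.divisors : ℝ) * (polyRootCountMod ![g] m : ℝ) / m) ≤ ∏ p ∈ Nat.primesLE N, (1 + 2 * (polyRootCountMod ![g] p : ℝ) / p + 16 * W / (p : ℝ) ^ 2) := by
  have hsumm : ∀ {p : ℕ}, p.Prime → Summable (fun e : ℕ => ((#(p ^ e).divisors : ℝ) * (polyRootCountMod ![g] (p ^ e) : ℝ) / (p ^ e : ℕ))) := fun {p} hp =>
    summable_of_sum_range_le (fun e => tauRhoDiv_nonneg g _) (sum_range_tauRhoDiv_prime_pow_le hp (hW p hp))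
  calc ∑ m ∈ Icc 1 N, ((#m.divisors : ℝ) * (polyRootCountMod ![g] m : ℝ) / m) ≤ ∏ p ∈ Nat.primesLE N, ∑' e : ℕ, ((#(p ^ e).divisors : ℝ) * (polyRootCountMod ![g] (p ^ e) : ℝ) / (p ^ e : ℕ)) := by
        refine BombieriSieve.sum_le_prod_tsum_of_factored (h := fun m : ℕ => (#m.divisors : ℝ) * (polyRootCountMod ![g] m : ℝ) / m) (tauRhoDiv_one g)
          (fun {m n} hmn => tauRhoDiv_mul hmn) (tauRhoDiv_nonneg g) (fun {p} hp => hsumm hp)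
          (fun p hp => Nat.prime_of_mem_primesLE hp) (fun d hd => ?_)
        obtain ⟨hd1, hdN⟩ := mem_Icc.mp hd
        rw [Nat.mem_factoredNumbers']
        intro p hp hpd
        exact Nat.mem_primesLE.mpr ⟨(Nat.le_of_dvd (by omega) hpd).trans hdN, hp⟩
    _ ≤ ∏ p ∈ Nat.primesLE N, (1 + 2 * (polyRootCountMod ![g] p : ℝ) / p + 16 * W / (p : ℝ) ^ 2) := by
        refine Finset.prod_le_prod (fun p _ => tsum_nonneg fun e => tauRhoDiv_nonneg g _) fun p hp => ?_
        have hp := Nat.prime_of_mem_primesLE hp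
        exact Real.tsum_le_of_sum_range_le (fun e => tauRhoDiv_nonneg g _)
          (sum_range_tauRhoDiv_prime_pow_le hp (hW p hp))

/-- `1 + 2t + s ≤ (1 − t)⁻² (1 + s)` for `0 ≤ t < 1`, `0 ≤ s`. [folklore] -/
theorem one_add_two_mul_add_le {t s : ℝ} (ht0 : 0 ≤ t) (ht1 : t < 1) (hs : 0 ≤ s) :
    1 + 2 * t + s ≤ ((1 - t) ^ 2)⁻¹ * (1 + s) := by
  have h1t : 0 < 1 - t := by linarith
  have hsq : 0 < (1 - t) ^ 2 := by positivity
  rw [← div_eq_inv_mul, le_div_iff₀ hsq]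
  nlinarith [sq_nonneg t, mul_nonneg hs ht0, mul_nonneg (mul_nonneg hs ht0) ht0]

/-- `∏_{p ≤ N} (1 + K/p²) ≤ exp (2K)` for `K ≥ 0`. [folklore] -/
theorem prod_primesLE_one_add_div_sq_le {K : ℝ} (hK : 0 ≤ K) (N : ℕ) :
    ∏ p ∈ Nat.primesLE N, (1 + K / (p : ℝ) ^ 2) ≤ Real.exp (2 * K) := by
  calc ∏ p ∈ Nat.primesLE N, (1 + K / (p : ℝ) ^ 2)
      ≤ ∏ p ∈ Nat.primesLE N, Real.exp (K / (p : ℝ) ^ 2) :=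
        Finset.prod_le_prod (fun p _ => by positivity) fun p _ => by
          linarith [Real.add_one_le_exp (K / (p : ℝ) ^ 2)]
    _ = Real.exp (∑ p ∈ Nat.primesLE N, K / (p : ℝ) ^ 2) := by rw [Real.exp_sum]
    _ ≤ Real.exp (2 * K) := by
        refine Real.exp_le_exp.mpr ?_
        have hsub : Nat.primesLE N ⊆ Finset.Ioo 1 (N + 1) := fun p hp => by
          have h := Nat.mem_primesLE.mp hp
          exact mem_Ioo.mpr ⟨h.2.one_lt, Nat.lt_succ_of_le h.1⟩
        calc ∑ p ∈ Nat.primesLE N, K / (p : ℝ) ^ 2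
            ≤ ∑ p ∈ Finset.Ioo 1 (N + 1), K / (p : ℝ) ^ 2 :=
              Finset.sum_le_sum_of_subset_of_nonneg hsub fun p _ _ => by positivity
          _ = K * ∑ p ∈ Finset.Ioo 1 (N + 1), ((p : ℝ) ^ 2)⁻¹ := by
              rw [Finset.mul_sum]; refine Finset.sum_congr rfl fun p _ => ?_; rw [div_eq_mul_inv]
          _ ≤ K * (2 / ((1 : ℕ) + 1)) := by
              gcongr; exact sum_Ioo_inv_sq_le 1 (N + 1)
          _ ≤ 2 * K := by norm_num; linarith

/-- **The Euler majorant against the sieve product**: with `ρ_g(p^a) ≤ W` for all prime powers and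
no fixed prime divisor, `∑_{m ≤ N} τ(m)ρ_g(m)/m ≤ e^{32W} · P_g(N)⁻²`. [folklore] -/
theorem sum_tauRhoDiv_le_exp_div_sieveProd_sq {g : ℤ[X]} (hg : HasNoFixedPrimeDivisor ![g]) {W : ℝ}
    (hW : ∀ p : ℕ, p.Prime → ∀ a : ℕ, (polyRootCountMod ![g] (p ^ a) : ℝ) ≤ W) (N : ℕ) :
    ∑ m ∈ Icc 1 N, ((#m.divisors : ℝ) * (polyRootCountMod ![g] m : ℝ) / m) ≤ Real.exp (32 * W) * (((∏ p ∈ Nat.primesLE N, (1 - (polyRootCountMod ![g] p : ℝ) / p))) ^ 2)⁻¹ := by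
  have hW0 : 0 ≤ W := (rho_nonneg g (2 ^ 0)).trans (hW 2 Nat.prime_two 0)
  refine (sum_tauRhoDiv_le_prod hW N).trans ?_
  -- factor by factor: `1 + 2t + s ≤ (1−t)⁻² (1+s)`
  have hfac : ∀ p ∈ Nat.primesLE N,
      1 + 2 * (polyRootCountMod ![g] p : ℝ) / p + 16 * W / (p : ℝ) ^ 2 ≤ ((1 - (polyRootCountMod ![g] p : ℝ) / p) ^ 2)⁻¹ * (1 + 16 * W / (p : ℝ) ^ 2) := by
    intro p hp
    have hp := Nat.prime_of_mem_primesLE hp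
    have hp0 : (0 : ℝ) < p := by exact_mod_cast hp.pos
    have ht1 : (polyRootCountMod ![g] p : ℝ) / p < 1 := by
      rw [div_lt_one hp0]; exact_mod_cast hg p hp
    have := one_add_two_mul_add_le (t := (polyRootCountMod ![g] p : ℝ) / p) (s := 16 * W / (p : ℝ) ^ 2)
      (by positivity) ht1 (by positivity)
    simpa [mul_div_assoc] using this
  calc ∏ p ∈ Nat.primesLE N, (1 + 2 * (polyRootCountMod ![g] p : ℝ) / p + 16 * W / (p : ℝ) ^ 2)
      ≤ ∏ p ∈ Nat.primesLE N, ((1 - (polyRootCountMod ![g] p : ℝ) / p) ^ 2)⁻¹ * (1 + 16 * W / (p : ℝ) ^ 2) :=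
        Finset.prod_le_prod (fun p _ => by positivity) hfac
    _ = (((∏ p ∈ Nat.primesLE N, (1 - (polyRootCountMod ![g] p : ℝ) / p))) ^ 2)⁻¹ * ∏ p ∈ Nat.primesLE N, (1 + 16 * W / (p : ℝ) ^ 2) := by
        rw [Finset.prod_mul_distrib, Finset.prod_inv_distrib, ← Finset.prod_pow]
    _ ≤ (((∏ p ∈ Nat.primesLE N, (1 - (polyRootCountMod ![g] p : ℝ) / p))) ^ 2)⁻¹ * Real.exp (2 * (16 * W)) :=
        mul_le_mul_of_nonneg_left (prod_primesLE_one_add_div_sq_le (by positivity) N)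
          (inv_nonneg.mpr (sq_nonneg _))
    _ = Real.exp (32 * W) * (((∏ p ∈ Nat.primesLE N, (1 - (polyRootCountMod ![g] p : ℝ) / p))) ^ 2)⁻¹ := by ring_nf

end Summit.Parity.BatemanHorn.Theorems
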